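import Mathlib
import HarnessLib
import Summits.HubbardSuperconductivity.HubbardSuperconductivity.Theorems.KLProgrammeKLRegimeCountertermSlotBudgetSelfMap
import Summits.HubbardSuperconductivity.HubbardSuperconductivity.Theorems.KLProgrammeKLRegimeCountertermOneVolumeJS

/-!
# Route `KLProgramme` — child Counterterm of crux K3: SELF-MAP PROVIDERS for `ct_oneVolume_thresholdsJS`
# (seat hubbard-kl-k3c3-p2, «fixed point on FrameOK's tube»)

`ct_oneVolume_thresholdsJS` (`…CountertermOneVolumeJS`, p497366) takes the admissibility of the smoothed Picard iterate from a SELF-MAP PROVIDER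
for the package `ctRenMs G` — `∃ c₄ U₄ > 0, ∀ (c ≤ c₄, U ≤ U₄, β, μ, L, M, d), ∀ K admissible, ∀ n ≤ N, (∀ i ≤ n, X L M β U μ K i) →
FrameOK (ctRenMs G) U N μ (ctIterJ L M d β U μ K n)` — keyed by the per-scale slot conjunct `X`.  This file supplies two providers:

* `selfMapProvider_msBar` — TODAY's text: `X := TwoLegSizesMSFn … K.eval` (the V13/V14 conjunct `TwoLegSizesMST`), from `ctRenMs_thresholds`
  (rooms (ha)/(hb) + the three allowance sums) and `frameOK_jackson_of_multiSlotFn'`; so `countertermP2_klPredsV14` factors through the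
  self-map-supplied chain (checked seat-side; not re-landed — dedup);
* `geomBudget_thresholds` + `selfMapProvider_geom` — the slope + U-free-geometric shape with the `Gfr j + S j + 1` floor of MS-CONSUMER.md §1 (C2)
  (`κ = 1/8`): `X := ∃ lp, decomposition ∧ symmetric C⁴ slots ∧ own-slot twoLegBar ∧ ‖Dʲ lp m‖ ≤ (msBar i + (1/8)(1/2)^{m−i})·((Gfr j + S j + 1)·uPow j U·4^{(j−2)m})`,
  from `frameOK_jackson_of_geomBudget` (p496425) under the thresholds `S′ j·|U| ≤ 1/2` (j ≤ 4) and `Σ_{i≤n} msBar i + 1/8 ≤ 1/3`.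
So, should a later bundle re-type (E3a-MS) in that shape, child 2 re-closes by `ct_oneVolume_thresholdsJS … selfMapProvider_geom` + the bundle
one-liner.  Proofs only; no slot text is proposed here; nothing is asserted about the Hubbard model.
-/

noncomputable section

namespace Summit.HubbardSuperconductivity.HubbardSuperconductivity.Theorems.KLRegimeSplit

set_option linter.dupNamespace false -- summit = problem name (single-conjunct summit), D-0017

open Real Finset
open Literature.MathematicalPhysics.QuantumLattice Literature.Probability.LatticeModels
open Summit.HubbardSuperconductivity.HubbardSuperconductivity.Theorems.KLProgrammeLegKernels

/-! ## §1 Today's text -/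

/-- **Self-map provider for TODAY's (E3a-MS) text** (`X := TwoLegSizesMSFn … K.eval`, package `ctRenMs G`): thresholds = `ctRenMs_thresholds`'s
`c₂, U₂`; the iterate's admissibility = `frameOK_jackson_of_multiSlotFn'` with the sharp room from (ha)/(hb). -/
theorem selfMapProvider_msBar (G : GeoConsts) (Q : EngConsts) (hG : G.WF) (hQ : Q.WF) :
    ∃ c₄ : ℝ, 0 < c₄ ∧ ∃ U₄ : ℝ, 0 < U₄ ∧ ∀ c U β : ℝ, 0 < c → c ≤ c₄ → 0 < U → U ≤ U₄ →
      klBetaMin ≤ β → β ≤ Real.exp (c / U ^ 2) → ∀ μ ∈ klWindowC, ∀ (L M : ℕ) [NeZero L] [NeZero M] (d : ℕ),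
        ∀ K : TrigPolyC4v, FrameOK (ctRenMs G) U (nScales β) μ K → ∀ n : ℕ, n ≤ nScales β →
          (∀ i ≤ n, TwoLegSizesMSFn L M G Q (ctRenMs G) β U μ K.eval i) →
            FrameOK (ctRenMs G) U (nScales β) μ (ctIterJ L M d β U μ K n) := by
  have hR : ∀ j, 0 ≤ (ctRenMs G).Gfr j := (ctRenMs_WF2 hG).1.2.2
  obtain ⟨c₂, hc₂, U₂, hU₂, thr⟩ := ctRenMs_thresholds (G := G) (Q := Q) hG hQ
  refine ⟨c₂, hc₂, U₂, hU₂, fun c U β hc hcc hU hUU hβ hβc μ hμ L M _ _ d K hK n hn hX => ?_⟩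
  obtain ⟨hroomA, hroomB, h0, h1, h2⟩ := thr c U β hc.le hcc hU hUU hβ hβc
  have hroom := sharpRoom_of_rooms (G := G) (Q := Q) hR hroomA hroomB (nScales β)
  have hμw : μ ∈ Set.Icc (-1.05 : ℝ) (-0.15) := hμ
  exact frameOK_jackson_of_multiSlotFn' (L := L) (M := M) hG hQ hR hn hμw hX (hroom n hn) h0 h1 h2 d

/-! ## §2 The slope + U-free geometric shape with the `Gfr j + S j + 1` floor -/

/-- **Thresholds of the geometric-budget room** at `R = ctRenMs G`: for `0 ≤ c ≤ c₂`, `0 < U ≤ U₅` and `klBetaMin ≤ β ≤ e^{c/U²}`: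
`S′ j·|U| ≤ 1/2` (`j ≤ 4`), `Σ_{i≤n} msBar i + 1/8 ≤ 1/3` (every `n`), and the three allowance sums `≤ 3/80, 1/2000, 1/100`. -/
theorem geomBudget_thresholds {G : GeoConsts} {Q : EngConsts} (hG : G.WF) (hQ : Q.WF) :
    ∃ c₂ : ℝ, 0 < c₂ ∧ ∃ U₅ : ℝ, 0 < U₅ ∧ ∀ c U β : ℝ, 0 ≤ c → c ≤ c₂ → 0 < U → U ≤ U₅ →
      klBetaMin ≤ β → β ≤ Real.exp (c / U ^ 2) →
        (∀ j ≤ 4, Q.S' j * |U| ≤ 1 / 2) ∧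
        (∀ n : ℕ, (∑ i ∈ range (n + 1), msBar G Q U i) + 1 / 8 ≤ 1 / 3) ∧
        (∑ m ∈ range (nScales β + 1), (ctRenMs G).Gfr 0 * uPow 0 U * (4 : ℝ) ^ (((0 : ℤ) - 2) * m) ≤ 3 / 80) ∧
        (∑ m ∈ range (nScales β + 1), (ctRenMs G).Gfr 1 * uPow 1 U * (4 : ℝ) ^ (((1 : ℤ) - 2) * m) ≤ 1 / 2000) ∧
        (∑ m ∈ range (nScales β + 1), ∑ j ∈ range 3,
            (ctRenMs G).Gfr j * uPow j U * (4 : ℝ) ^ (((j : ℤ) - 2) * m) ≤ 1 / 100) := by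
  have hR : ∀ j, 0 ≤ (ctRenMs G).Gfr j := (ctRenMs_WF2 hG).1.2.2
  have hS : 0 ≤ G.S 1 := hG.2.2.2.2.2.2.2.2.2.2.2.2.2.2.2.2.2.1 1
  have hS' : ∀ j, 0 ≤ Q.S' j := hQ.2.2.2.2.1
  have hκ := klMsKappa_pos
  obtain ⟨c₂, hc₂, U₂, hU₂, hthr⟩ := allowanceSums_thresholds hR
  set A : ℝ := Q.S' 0 + Q.S' 1 + Q.S' 2 + Q.S' 3 + Q.S' 4 + 1 with hA_def
  set B : ℝ := klMsKappa * (G.S 1 + Q.S' 1) * (4 / 3) + 1 with hB_def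
  have hA : 0 < A := by
    have := hS' 0; have := hS' 1; have := hS' 2; have := hS' 3; have := hS' 4
    rw [hA_def]; linarith
  have hB : 0 < B := by rw [hB_def]; have := hS' 1; positivity
  refine ⟨c₂, hc₂, min U₂ (min 1 (min (1 / (2 * A)) (5 / (24 * B)))), ?_, ?_⟩
  · exact lt_min hU₂ (lt_min one_pos (lt_min (by positivity) (by positivity)))
  intro c U β hc hcle hU hUle hβmin hβc
  have hUU₂ : U ≤ U₂ := hUle.trans (min_le_left _ _)
  have hU1 : U ≤ 1 := (hUle.trans (min_le_right _ _)).trans (min_le_left _ _)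
  have hUA : U ≤ 1 / (2 * A) := ((hUle.trans (min_le_right _ _)).trans (min_le_right _ _)).trans (min_le_left _ _)
  have hUB : U ≤ 5 / (24 * B) := ((hUle.trans (min_le_right _ _)).trans (min_le_right _ _)).trans (min_le_right _ _)
  obtain ⟨h0, h1, h2⟩ := hthr c U β hc hcle hU hUU₂ hβmin hβc
  refine ⟨fun j hj => ?_, fun n => ?_, h0, h1, h2⟩
  · -- `S′ j·U ≤ A·U/… ≤ 1/2`
    rw [abs_of_nonneg hU.le]
    have hle : Q.S' j ≤ A := by
      have := hS' 0; have := hS' 1; have := hS' 2; have := hS' 3; have := hS' 4; have := hS' j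
      interval_cases j <;> (rw [hA_def]; linarith)
    have h2A : 0 < 2 * A := by positivity
    have hUA' := (le_div_iff₀ h2A).mp hUA
    nlinarith [hS' j]
  · -- `Σ msBar ≤ B·U ≤ 5/24`
    have hsum := sum_msBar_le hG hQ U (n + 1)
    rw [abs_of_nonneg hU.le] at hsum
    have hU2 : U ^ 2 ≤ U := by nlinarith
    have h1' : G.S 1 + Q.S' 1 * U ≤ G.S 1 + Q.S' 1 := by nlinarith [hS' 1]
    have hstep : klMsKappa * (G.S 1 + Q.S' 1 * U) * U ^ 2 * (4 / 3) ≤ B * U := by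
      have ha : 0 ≤ klMsKappa * (G.S 1 + Q.S' 1 * U) := by have := hS' 1; positivity
      have hb : 0 ≤ klMsKappa * (G.S 1 + Q.S' 1) := by have := hS' 1; positivity
      calc klMsKappa * (G.S 1 + Q.S' 1 * U) * U ^ 2 * (4 / 3)
            ≤ klMsKappa * (G.S 1 + Q.S' 1 * U) * U * (4 / 3) := by nlinarith [mul_nonneg ha (sub_nonneg.2 hU2)]
        _ ≤ klMsKappa * (G.S 1 + Q.S' 1) * U * (4 / 3) := by
              nlinarith [mul_nonneg (mul_nonneg hκ.le (sub_nonneg.2 h1')) hU.le]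
        _ ≤ B * U := by rw [hB_def]; nlinarith [hU.le]
    have h24B : 0 < 24 * B := by positivity
    have hUB' := (le_div_iff₀ h24B).mp hUB
    linarith

/-- **Self-map provider for the slope + U-free-geometric shape with the `Gfr j + S j + 1` floor** (`κ = 1/8`, package `ctRenMs G`):
from `frameOK_jackson_of_geomBudget` under `geomBudget_thresholds`. -/
theorem selfMapProvider_geom (G : GeoConsts) (Q : EngConsts) (hG : G.WF) (hQ : Q.WF) :
    ∃ c₄ : ℝ, 0 < c₄ ∧ ∃ U₄ : ℝ, 0 < U₄ ∧ ∀ c U β : ℝ, 0 < c → c ≤ c₄ → 0 < U → U ≤ U₄ →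
      klBetaMin ≤ β → β ≤ Real.exp (c / U ^ 2) → ∀ μ ∈ klWindowC, ∀ (L M : ℕ) [NeZero L] [NeZero M] (d : ℕ),
        ∀ K : TrigPolyC4v, FrameOK (ctRenMs G) U (nScales β) μ K → ∀ n : ℕ, n ≤ nScales β →
          (∀ i ≤ n, ∃ lp : ℕ → FrameFn,
            (∀ p : Fin 2 → ℝ, klTwoLegPieceFn L M β U μ K.eval i p = lp i p + ∑ m ∈ Ioc i (nScales β), lp m p) ∧
            (∀ m, IsSymmetricFrame (lp m) ∧ ContDiff ℝ 4 (onM (lp m))) ∧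
            (∀ j ≤ 4, ∀ q : Momentum, ‖iteratedFDeriv ℝ j (onM (lp i)) q‖ ≤ twoLegBar G Q U j i) ∧
            (∀ m ∈ Ioc i (nScales β), ∀ j ≤ 4, ∀ q : Momentum, ‖iteratedFDeriv ℝ j (onM (lp m)) q‖ ≤
              (msBar G Q U i + 1 / 8 * (1 / 2 : ℝ) ^ (m - i)) *
                (((ctRenMs G).Gfr j + G.S j + 1) * uPow j U * (4 : ℝ) ^ (((j : ℤ) - 2) * m)))) →
            FrameOK (ctRenMs G) U (nScales β) μ (ctIterJ L M d β U μ K n) := by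
  have hR : ∀ j, 0 ≤ (ctRenMs G).Gfr j := (ctRenMs_WF2 hG).1.2.2
  obtain ⟨c₂, hc₂, U₅, hU₅, thr⟩ := geomBudget_thresholds (G := G) (Q := Q) hG hQ
  refine ⟨c₂, hc₂, U₅, hU₅, fun c U β hc hcc hU hUU hβ hβc μ hμ L M _ _ d K hK n hn hX => ?_⟩
  obtain ⟨hS', hsmall, h0, h1, h2⟩ := thr c U β hc.le hcc hU hUU hβ hβc
  have hμw : μ ∈ Set.Icc (-1.05 : ℝ) (-0.15) := hμ
  have hGfr : ∀ j ≤ 4, (ctRenMs G).Gfr j = 2 * (G.S j + 1) := fun j _ => rfl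
  exact frameOK_jackson_of_geomBudget (L := L) (M := M) hG hQ hR hn hμw (κ := 1 / 8) (by norm_num) hX hGfr hS' (hsmall n)
    h0 h1 h2 d

end Summit.HubbardSuperconductivity.HubbardSuperconductivity.Theorems.KLRegimeSplit

end
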